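import Summits.MatrixMultiplication.OmegaCensus.STPPCell22Sound6
import Summits.MatrixMultiplication.OmegaCensus.STPPCell22NF
import Summits.MatrixMultiplication.OmegaCensus.STPPCell22TablesA
import Summits.MatrixMultiplication.OmegaCensus.STPPCell22Tables
import Summits.MatrixMultiplication.OmegaCensus.STPPVosperSlackTwoCoverDead
import Summits.MatrixMultiplication.OmegaCensus.STPPVosperSlackTwoSoundCTools
import Summits.MatrixMultiplication.OmegaCensus.STPPBlockVolumeFilter

/-!
# ω-census (abelian STPP census): the cell-(2,2) law of the fifth leaf `{(2,2,2),(3,3,3)²} @ ℤ₆₁` — CORE (renormalised family ⇒ False)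

HONEST FRAMING (pub-omega census; verbatim): lottery ticket; floor = certified bounds/negative ranges.
Census STRUCTURE (seat pub-omega-stpp-1 gen 33, 2026-08-29), family (b2).  `cell22_core`: steps S3–S8 of the cell-(2,2) law (plan HOME
`pub-omega-stpp-1-g33/FIFTH-LEAF.md` §SOUNDNESS) for a family ALREADY in normal form (`−Aᵢ = {0,1,y₀}`, `−Bᵢ = w•{0,1,y₀'}`, `0 ∈ Y°`, `60 ∉ Y°`,
both sumsets of size 17): the zoo on both pairs (`zoo313_61_of_rows`, modulo the root row `hrows`), normalised entries and shapes (stage-0 rows),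
masks of `SY″/T″/W″` after translating by `−t₁`, the exact cover (`coverK_complete`), the closure pre-filters (`closure_test_eq`), admissibility,
`mem_plc_of_place22` (stage-1 rows `hS1`), `lookup22_of_real22` (stage 2 `hS2`), the link row `hsub`, and `CoverDead` (`hdead`).  The renormalisation
itself is `STPPCell22Law.cell22_false`.  No `decide` beyond numerals; nothing here is progress on `ω`.

References: H. Cohn, R. Kleinberg, B. Szegedy, C. Umans, FOCS 2005, Def. 5.1.
-/

open Finset
open scoped Pointwise

namespace Summit.MatrixMultiplication.OmegaCensus.CubeNB.S2

open Literature.Computability.AlgebraicComplexity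
open Literature.Combinatorics.Additive
open Summit.MatrixMultiplication.OmegaCensus.STPPKneser
open Summit.MatrixMultiplication.OmegaCensus.CubeNB.Bits

/-- **Cell (2,2), core**: a renormalised family (`−Aᵢ = {0,1,y₀}`, `−Bᵢ = w•{0,1,y₀'}`, `0 ∈ Y°`, `60 ∉ Y°`, `#SY = #T = 17`, other blocks
`(3,3,3),(2,2,2)`) contradicts the certified rows. [cite: CohnKleinbergSzegedyUmans2005, Def. 5.1] -/
theorem cell22_core [Fact (Nat.Prime 61)] (hrows : zooGo 61 zooTbl61 12 59 3 0 1 [0] = true) {N : ℕ} {A3 B3 C3 : Fin N → Finset (ZMod 61)}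
    (hS3' : IsSTPP A3 B3 C3) (hA3ne : ∀ k, (A3 k).Nonempty) (hB3ne : ∀ k, (B3 k).Nonempty) (hC3ne : ∀ k, (C3 k).Nonempty) (i : Fin N)
    (ha3 : #(A3 i) = 3) (hb3 : #(B3 i) = 3) (hc3 : #(C3 i) = 3)
    (hY3card : #(DU B3 C3 (univ.erase i)) = 13) (hZ3card : #(DU A3 C3 (univ.erase i)) = 13)
    (ks : List (Fin N)) (hks : ks.Nodup) (hksi : ∀ k, k ∈ ks ↔ k ≠ i)
    (hszs3 : ks.map (fun k => (#(A3 k), #(B3 k), #(C3 k))) = [(3, 3, 3), (2, 2, 2)])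
    {y₀ y₀' : ℕ} (hy₀ : y₀ = 2 ∨ y₀ = 3 ∨ y₀ = 4) (hy₀' : y₀' = 2 ∨ y₀' = 3 ∨ y₀' = 4) {w : ZMod 61} (hw0 : w ≠ 0)
    (hF1 : (A3 i).image (fun x => (0 : ZMod 61) - x) = {0, 1, ((y₀ : ℕ) : ZMod 61)})
    (hF2 : (B3 i).image (fun x => (0 : ZMod 61) - x) = ({0, 1, ((y₀' : ℕ) : ZMod 61)} : Finset (ZMod 61)).image (w * ·))
    (h0Y : (0 : ZMod 61) ∈ DU B3 C3 (univ.erase i)) (h60Y : (60 : ZMod 61) ∉ DU B3 C3 (univ.erase i))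
    (hSY3 : #((A3 i).image (fun x => (0 : ZMod 61) - x) + DU B3 C3 (univ.erase i)) = 17)
    (hT3 : #((B3 i).image (fun x => (0 : ZMod 61) - x) + DU A3 C3 (univ.erase i)) = 17)
    (hS1 : ∀ b ∈ zooShp61, ∀ w ∈ List.range' 1 60, place22Row 61 zooShp61 plc22 b w = true)
    (hS2 : (plc22.all (real22 61 zooNrm61 tbl22G)) = true)
    (hsub : (tbl22G.all fun g => g.2.all fun z => tbl22F.any fun e => Nat.beq e.1 g.1 && Nat.beq e.2 z) = true)
    (hdead : ∀ e ∈ tbl22F, CoverDead 61 N i [(3, 3, 3), (2, 2, 2)] (members (List.range 61) e.1) (members (List.range 61) e.2)) : False := by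
  have hp0 : (0 : ℕ) < 61 := by norm_num
  -- ── S3 (A-side): zoo on `(−A'ᵢ, Y°')`, normalised entry, shape ──
  set yA : ZMod 61 := ((y₀ : ℕ) : ZMod 61) with hyA
  have hy₀lt : y₀ < 61 := by omega
  have hyAval : yA.val = y₀ := by rw [hyA, ZMod.val_natCast, Nat.mod_eq_of_lt hy₀lt]
  have h17A : #(({0, 1, yA} : Finset (ZMod 61)) + (DU B3 C3 (univ.erase i))) = 17 := by rw [← hF1]; exact hSY3
  have hzA := zoo313_61_of_rows hrows (DU B3 C3 (univ.erase i)) yA hY3card h0Y h60Y (by rw [hyAval]; omega) (by rw [hyAval]; omega) h17A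
  rw [hyAval] at hzA
  set mY := maskOf (((DU B3 C3 (univ.erase i)).image ZMod.val).sort (· ≤ ·)) with hmY
  have hrepY : ∀ v, tb mY v = true ↔ ∃ x ∈ (DU B3 C3 (univ.erase i)), x.val = v := tb_valMask (DU B3 C3 (univ.erase i))
  have hnlA := mem_of_nrmListed (nrmListed_of_row zooTbl61_nrm hzA (by simpa using hy₀))
  set S1 := s1Mask 61 y₀ mY with hS1def
  set σ₁ := nrmMask 61 S1 with hσ₁
  set t₁ := offMask 61 σ₁ S1 with ht₁
  have hshpA : (y₀, σ₁) ∈ zooShp61 := mem_shp_of_row zooNrm61_shp hnlA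
  have hrot1 : rot 61 σ₁ t₁ = S1 := rot_nrmMask_offMask (s1Mask_lt_two_pow (valMask_lt_two_pow (DU B3 C3 (univ.erase i))))
  have hrepSY : ∀ v, tb S1 v = true ↔ ∃ x ∈ ({0, 1, yA} : Finset (ZMod 61)) + (DU B3 C3 (univ.erase i)), x.val = v := by
    have := rep_s1Mask hrepY yA; rwa [hyAval] at this
  -- ── S3 (B-side): zoo on `({0,1,y₀'}, w⁻¹•Z°' − e₂)` ──
  set Z₁ := (DU A3 C3 (univ.erase i)).image (fun x => w⁻¹ * x) with hZ₁
  have hwi : w⁻¹ ≠ 0 := inv_ne_zero hw0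
  have hZ₁card : #Z₁ = 13 := by rw [hZ₁, card_image_of_injective _ (mul_right_injective₀ hwi), hZ3card]
  obtain ⟨e₂, he₂, he₂1⟩ := exists_mem_sub_not_mem (S := Z₁) (by rw [← card_pos, hZ₁card]; norm_num)
    (by intro h; have := congrArg card h; rw [hZ₁card, card_univ, ZMod.card] at this; norm_num at this) one_ne_zero
  set Y'' := Z₁.image (fun x => x + -e₂) with hY''
  have hY''card : #Y'' = 13 := by rw [hY'', card_image_of_injective _ (add_left_injective _), hZ₁card]
  have h0Y'' : (0 : ZMod 61) ∈ Y'' := mem_image.2 ⟨e₂, he₂, by ring⟩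
  have h60Y'' : (60 : ZMod 61) ∉ Y'' := sixty_not_mem_image he₂1
  set yB : ZMod 61 := ((y₀' : ℕ) : ZMod 61) with hyB
  have hy₀'lt : y₀' < 61 := by omega
  have hyBval : yB.val = y₀' := by rw [hyB, ZMod.val_natCast, Nat.mod_eq_of_lt hy₀'lt]
  have hZ3Y'' : (DU A3 C3 (univ.erase i)) = Y''.image (fun x => w * (x + e₂)) := by
    rw [hY'', hZ₁, image_image, image_image]
    ext x
    simp only [mem_image, Function.comp]
    constructor
    · intro hx; exact ⟨x, hx, by rw [neg_add_cancel_right, mul_inv_cancel_left₀ hw0]⟩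
    · rintro ⟨v, hv, rfl⟩; rw [neg_add_cancel_right, mul_inv_cancel_left₀ hw0]; exact hv
  have hP : ((({0, 1, yB} : Finset (ZMod 61)).image (w * ·)).image (fun x => w⁻¹ * x + 0)) = {0, 1, yB} := by
    rw [image_image]
    have hc : ((fun x => w⁻¹ * x + 0) ∘ (fun x => w * x)) = id := by
      funext v; simp only [Function.comp, id]; rw [inv_mul_cancel_left₀ hw0, add_zero]
    rw [hc, image_id]
  have hQ : (DU A3 C3 (univ.erase i)).image (fun x => w⁻¹ * x + -e₂) = Y'' := by rw [hY'', hZ₁, image_image]; rfl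
  have hT3img : (({0, 1, yB} : Finset (ZMod 61)) + Y'') =
      ((B3 i).image (fun x => (0 : ZMod 61) - x) + (DU A3 C3 (univ.erase i))).image (fun x => w⁻¹ * x + ((0 : ZMod 61) + -e₂)) := by
    rw [image_affine_add, hF2, hP, hQ]
  have h17B : #(({0, 1, yB} : Finset (ZMod 61)) + Y'') = 17 := by
    rw [hT3img, card_image_of_injective _ fun v v' hh => mul_left_cancel₀ hwi (add_right_cancel hh), hT3]
  have hzB := zoo313_61_of_rows hrows Y'' yB hY''card h0Y'' h60Y'' (by rw [hyBval]; omega) (by rw [hyBval]; omega) h17B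
  rw [hyBval] at hzB
  set m₂ := maskOf ((Y''.image ZMod.val).sort (· ≤ ·)) with hm₂
  have hrepY'' : ∀ v, tb m₂ v = true ↔ ∃ x ∈ Y'', x.val = v := tb_valMask Y''
  have hnlB := mem_of_nrmListed (nrmListed_of_row zooTbl61_nrm hzB (by simpa using hy₀'))
  set S2 := s1Mask 61 y₀' m₂ with hS2def
  set σ₂ := nrmMask 61 S2 with hσ₂
  set t₂ := offMask 61 σ₂ S2 with ht₂
  have hshpB : (y₀', σ₂) ∈ zooShp61 := mem_shp_of_row zooNrm61_shp hnlB
  have hrot2 : rot 61 σ₂ t₂ = S2 := rot_nrmMask_offMask (s1Mask_lt_two_pow (valMask_lt_two_pow Y''))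
  have hrepS2 : ∀ v, tb S2 v = true ↔ ∃ x ∈ ({0, 1, yB} : Finset (ZMod 61)) + Y'', x.val = v := by
    have := rep_s1Mask hrepY'' yB; rwa [hyBval] at this
  -- ── S6: translate by `−t₁`; masks of `SY″`, `T″`, `W″` ──
  have ht₁lt : t₁ < 61 := offMask_lt hp0
  have ht₂lt : t₂ < 61 := offMask_lt hp0
  set τ : ZMod 61 := -((t₁ : ℕ) : ZMod 61) with hτ
  have hτval : (t₁ + τ.val) % 61 = 0 := by
    have h1 : ((t₁ : ℕ) : ZMod 61) + τ = 0 := by rw [hτ]; ring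
    have h2 := congrArg ZMod.val h1
    rw [ZMod.val_add, ZMod.val_natCast, Nat.mod_eq_of_lt ht₁lt, ZMod.val_zero] at h2
    exact h2
  have hσ₁lt : σ₁ < 2 ^ 61 := nrmMask_lt_two_pow (s1Mask_lt_two_pow (valMask_lt_two_pow _))
  have hσ₂lt : σ₂ < 2 ^ 61 := nrmMask_lt_two_pow (s1Mask_lt_two_pow (valMask_lt_two_pow _))
  -- the three sets of the renormalised family and their translates
  set W3 := ((A3 i) ×ˢ ((B3 i) ×ˢ (C3 i))).image fun q : ZMod 61 × ZMod 61 × ZMod 61 => (0 : ZMod 61) + q.2.2 - q.1 - q.2.1 with hW3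
  set SY3 := (A3 i).image (fun x => (0 : ZMod 61) - x) + DU B3 C3 (univ.erase i) with hSY3def
  set T3 := (B3 i).image (fun x => (0 : ZMod 61) - x) + DU A3 C3 (univ.erase i) with hT3def
  have hWSY : Disjoint W3 SY3 := disjoint_W_negA_add_DU hS3' i
  have hTWSY : Disjoint T3 (W3 ∪ SY3) := disjoint_negB_add_DU_AC hS3' i
  have hW3card : #W3 = 27 := by rw [hW3, card_image_blockSum hS3' i 0, ha3, hb3, hc3]
  have hpart : W3 ∪ SY3 ∪ T3 = univ := by
    apply eq_univ_of_card
    rw [card_union_of_disjoint hTWSY.symm, card_union_of_disjoint hWSY, hW3card, hSY3, hT3, ZMod.card]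
  -- `SY″ = SY3 + τ` is represented by `σ₁`
  have hrepσ₁ : ∀ v, tb σ₁ v = true ↔ ∃ x ∈ SY3.image (· + τ), x.val = v := by
    have h := rep_rot hrepSY τ
    rw [← hrot1, rot_rot hσ₁lt ht₁lt.le τ.val_lt.le, hτval, rot_zero' hσ₁lt] at h
    rw [hSY3def, hF1]; exact h
  -- `T3 = (({0,1,yB} + Y″)•w) + w e₂`, represented by `rot T0 c`, hence `T″` by `rot T0 s₁`
  obtain ⟨T0, hT0⟩ : ∃ T0, T0 = dilMask 61 σ₂ w.val := ⟨_, rfl⟩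
  have hT0lt : T0 < 2 ^ 61 := by rw [hT0]; exact dilMask_lt_two_pow hp0
  have hT3eq : T3 = ((({0, 1, yB} : Finset (ZMod 61)) + Y'').image (w * ·)).image (· + w * e₂) := by
    rw [hT3def, hF2, hZ3Y'']
    conv_rhs => rw [image_image]
    have e1 : ((· + w * e₂) ∘ (w * ·) : ZMod 61 → ZMod 61) = fun x => w * x + (0 + w * e₂) := by
      funext x; simp only [Function.comp, zero_add]
    have c1 : ({0, 1, yB} : Finset (ZMod 61)).image (fun x => w * x + 0) = ({0, 1, yB} : Finset (ZMod 61)).image (w * ·) :=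
      image_congr fun x _ => add_zero _
    have c2 : Y''.image (fun x => w * x + w * e₂) = Y''.image (fun x => w * (x + e₂)) :=
      image_congr fun x _ => (mul_add w x e₂).symm
    rw [e1, image_affine_add, c1, c2]
  have hrepS2w : ∀ v, tb (dilMask 61 S2 w.val) v = true ↔ ∃ x ∈ (({0, 1, yB} : Finset (ZMod 61)) + Y'').image (w * ·), x.val = v :=
    rep_dilMask hrepS2 w
  have hS2w : dilMask 61 S2 w.val = rot 61 T0 (w.val * t₂ % 61) := by rw [hT0, ← hrot2, dilMask_rot hp0 hσ₂lt ht₂lt.le]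
  set c := (w.val * t₂ % 61 + (w * e₂).val) % 61 with hcdef
  have hrepT3 : ∀ v, tb (rot 61 T0 c) v = true ↔ ∃ x ∈ T3, x.val = v := by
    have h := rep_rot hrepS2w (w * e₂)
    rw [hS2w, rot_rot hT0lt (Nat.mod_lt _ hp0).le (w * e₂).val_lt.le] at h
    rw [hT3eq]; exact h
  set s₁ := (c + τ.val) % 61 with hs₁
  have hs₁lt : s₁ < 61 := Nat.mod_lt _ hp0
  have hrepT'' : ∀ v, tb (rot 61 T0 s₁) v = true ↔ ∃ x ∈ T3.image (· + τ), x.val = v := by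
    have h := rep_rot hrepT3 τ
    rw [rot_rot hT0lt (Nat.mod_lt _ hp0).le τ.val_lt.le] at h
    exact h
  -- `W″ = W3 + τ` is represented by `full ⊕ (σ₁ ∪ rot T0 s₁)`
  have hpart' : (SY3.image (· + τ)) ∪ (W3.image (· + τ)) ∪ (T3.image (· + τ)) = univ := by
    rw [← image_union, ← image_union, union_comm SY3 W3, hpart, image_univ_of_surjective (add_right_surjective τ)]
  have hdisj1 : Disjoint (SY3.image (· + τ)) (W3.image (· + τ)) :=
    (disjoint_image (add_left_injective τ)).2 hWSY.symm
  have hdisj2 : Disjoint (T3.image (· + τ)) ((SY3.image (· + τ)) ∪ (W3.image (· + τ))) := by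
    rw [← image_union, union_comm SY3 W3]; exact (disjoint_image (add_left_injective τ)).2 hTWSY
  have hrepW0 := tb_compl_xor_iff_of_partition (p := 61) hrepσ₁ hrepT'' (rot_lt_two_pow _ _ _) hpart' hdisj1 hdisj2
  have hdisjST : Disjoint (SY3.image (· + τ)) (T3.image (· + τ)) :=
    (disjoint_image (add_left_injective τ)).2 (Disjoint.mono_left subset_union_right hTWSY.symm)
  have hdisjστ : ∀ v, ¬(tb σ₁ v = true ∧ tb (rot 61 T0 s₁) v = true) := by
    rintro v ⟨h1, h2⟩
    obtain ⟨x, hx, hxv⟩ := (hrepσ₁ v).1 h1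
    obtain ⟨x', hx', hx'v⟩ := (hrepT'' v).1 h2
    have hxx : x = x' := ZMod.val_injective 61 (by rw [hxv, hx'v])
    exact Finset.disjoint_left.1 hdisjST hx (hxx ▸ hx')
  have hrepW : ∀ v, tb (fullMask 61 ^^^ (σ₁ ||| rot 61 T0 s₁)) v = true ↔ ∃ x ∈ W3.image (· + τ), x.val = v := by
    rw [← compl_xor_eq_compl_or hσ₁lt (rot_lt_two_pow _ _ _) hdisjστ]; exact hrepW0
  -- ── S7: `W″ = (C3ᵢ + τ) + X`, exact cover, closure tests, admissibility ⇒ the placement is listed ──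
  set X := xMask 61 y₀ w.val y₀' with hXdef
  have hXlt : X < 2 ^ 61 := xMask_lt_two_pow hp0
  set Xs : Finset (ZMod 61) := ({0, 1, yA} : Finset (ZMod 61)) + ({0, 1, yB} : Finset (ZMod 61)).image (w * ·) with hXs
  have hwval1 : 1 ≤ w.val ∧ w.val < 61 := ⟨Nat.pos_of_ne_zero fun h => hw0 ((ZMod.val_eq_zero w).1 h), w.val_lt⟩
  -- `X` represents `Xs`
  have hrepX : ∀ v, tb X v = true ↔ ∃ x ∈ Xs, x.val = v := by
    rw [hXdef, hXs, hyA, hyB]; exact rep_xMask61 hy₀lt hy₀'lt w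
  -- `W3 = C3 i + Xs` and `W″ = (C3 i + τ) + Xs`
  set Cτ := (C3 i).image (· + τ) with hCτ
  have hW3eq : ∀ v : ZMod 61, v ∈ W3 ↔ ∃ cc ∈ C3 i, ∃ x ∈ Xs, cc + x = v := by
    intro v
    rw [hW3, mem_image]
    constructor
    · rintro ⟨⟨a, bb, cc⟩, hq, rfl⟩
      rw [mem_product, mem_product] at hq
      refine ⟨cc, hq.2.2, (0 - a) + (0 - bb), ?_, by ring⟩
      rw [hXs, ← hF1, ← hF2]
      exact add_mem_add (mem_image.2 ⟨a, hq.1, rfl⟩) (mem_image.2 ⟨bb, hq.2.1, rfl⟩)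
    · rintro ⟨cc, hcc, x, hx, rfl⟩
      rw [hXs, ← hF1, ← hF2] at hx
      obtain ⟨a', ha', b', hb', rfl⟩ := mem_add.1 hx
      obtain ⟨a, ha, rfl⟩ := mem_image.1 ha'
      obtain ⟨bb, hbb, rfl⟩ := mem_image.1 hb'
      exact ⟨(a, bb, cc), mem_product.2 ⟨ha, mem_product.2 ⟨hbb, hcc⟩⟩, by ring⟩
  have hW''eq : ∀ v : ZMod 61, v ∈ W3.image (· + τ) ↔ ∃ cc ∈ Cτ, ∃ x ∈ Xs, cc + x = v := by
    intro v
    rw [mem_image]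
    constructor
    · rintro ⟨v', hv', rfl⟩
      obtain ⟨cc, hcc, x, hx, rfl⟩ := (hW3eq v').1 hv'
      exact ⟨cc + τ, mem_image.2 ⟨cc, hcc, rfl⟩, x, hx, by ring⟩
    · rintro ⟨cc', hcc', x, hx, rfl⟩
      obtain ⟨cc, hcc, rfl⟩ := mem_image.1 hcc'
      exact ⟨cc + x, (hW3eq _).2 ⟨cc, hcc, x, hx, rfl⟩, by ring⟩
  -- the exact-cover test succeeds: `cs` = values of `Cτ`
  obtain ⟨hcsmem, hcsnd, hcslt, hcslen⟩ := valList_spec (p := 61) Cτ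
  set cs := (Cτ.image ZMod.val).sort (· ≤ ·) with hcs
  have hCτcard : #Cτ = 3 := by rw [hCτ, card_image_of_injective _ (add_left_injective τ), hc3]
  rw [hCτcard] at hcslen
  have h0Xs : (0 : ZMod 61) ∈ Xs := by
    have e0 : (0 : ZMod 61) = 0 + w * 0 := by ring
    rw [hXs, e0]; exact add_mem_add (by simp) (mem_image.2 ⟨0, by simp, rfl⟩)
  have hX0 : ∃ x < 61, tb X x = true := ⟨0, hp0, (hrepX 0).2 ⟨0, h0Xs, rfl⟩⟩
  have hiffW : ∀ v, tb (fullMask 61 ^^^ (σ₁ ||| rot 61 T0 s₁)) v = true ↔ v < 61 ∧ ∃ c' ∈ cs, tb (rot 61 X c') v = true := by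
    intro v
    rw [hrepW]
    constructor
    · rintro ⟨x, hx, rfl⟩
      obtain ⟨cc, hcc, xx, hxx, rfl⟩ := (hW''eq x).1 hx
      refine ⟨(cc + xx).val_lt, cc.val, (hcsmem _).2 ⟨cc, hcc, rfl⟩, ?_⟩
      rw [rep_rot hrepX cc]
      exact ⟨xx + cc, mem_image.2 ⟨xx, hxx, rfl⟩, by rw [add_comm]⟩
    · rintro ⟨-, c', hc', hv⟩
      obtain ⟨cc, hcc, rfl⟩ := (hcsmem c').1 hc'
      rw [rep_rot hrepX cc] at hv
      obtain ⟨e', he', rfl⟩ := hv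
      obtain ⟨xx, hxx, rfl⟩ := mem_image.1 he'
      exact ⟨xx + cc, (hW''eq _).2 ⟨cc, hcc, xx, hxx, by ring⟩, rfl⟩
  have hdisjC : ∀ c₁ ∈ cs, ∀ c₂ ∈ cs, c₁ ≠ c₂ → ∀ v, ¬(tb (rot 61 X c₁) v = true ∧ tb (rot 61 X c₂) v = true) := by
    intro c₁ hc₁ c₂ hc₂ hne v ⟨h1, h2⟩
    obtain ⟨cc₁, hcc₁, rfl⟩ := (hcsmem c₁).1 hc₁
    obtain ⟨cc₂, hcc₂, rfl⟩ := (hcsmem c₂).1 hc₂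
    rw [rep_rot hrepX] at h1 h2
    obtain ⟨e₁', he₁', hev⟩ := h1
    obtain ⟨e₂', he₂', hev'⟩ := h2
    have hee : e₁' = e₂' := ZMod.val_injective 61 (by rw [hev, hev'])
    obtain ⟨x₁, hx₁, rfl⟩ := mem_image.1 he₁'
    obtain ⟨x₂, hx₂, he2⟩ := mem_image.1 he₂'
    obtain ⟨d₁, hd₁, rfl⟩ := mem_image.1 hcc₁
    obtain ⟨d₂, hd₂, rfl⟩ := mem_image.1 hcc₂
    rw [hXs, ← hF1, ← hF2] at hx₁ hx₂
    obtain ⟨a₁', ha₁', b₁', hb₁', rfl⟩ := mem_add.1 hx₁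
    obtain ⟨a₂', ha₂', b₂', hb₂', rfl⟩ := mem_add.1 hx₂
    obtain ⟨a₁, ha₁, rfl⟩ := mem_image.1 ha₁'
    obtain ⟨a₂, ha₂, rfl⟩ := mem_image.1 ha₂'
    obtain ⟨bb₁, hbb₁, rfl⟩ := mem_image.1 hb₁'
    obtain ⟨bb₂, hbb₂, rfl⟩ := mem_image.1 hb₂'
    have key : d₁ - a₁ - bb₁ = d₂ - a₂ - bb₂ := by
      have h' : (0 - a₁ + (0 - bb₁) + (d₁ + τ) : ZMod 61) = 0 - a₂ + (0 - bb₂) + (d₂ + τ) := hee.trans he2.symm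
      linear_combination h'
    obtain ⟨-, -, hdd⟩ := blockSum_inj hS3' i ha₁ ha₂ hbb₁ hbb₂ hd₁ hd₂ key
    exact hne (by rw [hdd])
  have hK : coverK 61 X (members (List.range 61) X) 3 (fullMask 61 ^^^ (σ₁ ||| rot 61 T0 s₁)) = true :=
    coverK_complete hXlt hX0 3 cs _ hcslen hcslt hcsnd hiffW hdisjC
  -- values of the three-point sets
  have hval1 : (1 : ZMod 61).val = 1 := ZMod.val_one'' (by norm_num)
  have hvalw1 : (w * 1).val = w.val % 61 := by rw [mul_one, Nat.mod_eq_of_lt w.val_lt]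
  have hvalwy : (w * yB).val = w.val * y₀' % 61 := by rw [ZMod.val_mul, hyBval]
  -- closure test (Q side): `W″ = (Cτ + {0,1,yA}) + w{0,1,yB}`
  have hmemQ : ∀ v, tb (fullMask 61 ^^^ (σ₁ ||| rot 61 T0 s₁)) v = true ↔ v < 61 ∧ ∃ z, z < 61 ∧
      (∃ e ∈ Cτ + ({0, 1, yA} : Finset (ZMod 61)), e.val = z) ∧ ∃ q ∈ [0, w.val % 61, w.val * y₀' % 61], (z + q) % 61 = v := by
    intro v
    rw [hrepW]
    constructor
    · rintro ⟨x, hx, rfl⟩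
      obtain ⟨cc, hcc, xx, hxx, rfl⟩ := (hW''eq x).1 hx
      rw [hXs] at hxx
      obtain ⟨a', ha', b'', hb'', rfl⟩ := mem_add.1 hxx
      obtain ⟨b', hb', rfl⟩ := mem_image.1 hb''
      refine ⟨(cc + (a' + w * b')).val_lt, (cc + a').val, (cc + a').val_lt, ⟨cc + a', add_mem_add hcc ha', rfl⟩, (w * b').val, ?_, ?_⟩
      · simp only [mem_insert, mem_singleton] at hb'
        simp only [List.mem_cons, List.not_mem_nil, or_false]
        rcases hb' with rfl | rfl | rfl
        · left; simp
        · right; left; exact hvalw1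
        · right; right; exact hvalwy
      · rw [← ZMod.val_add, add_assoc]
    · rintro ⟨-, z, -, ⟨e, he, rfl⟩, q, hq, rfl⟩
      obtain ⟨cc, hcc, a', ha', rfl⟩ := mem_add.1 he
      simp only [List.mem_cons, List.not_mem_nil, or_false] at hq
      have hq' : ∃ b' ∈ ({0, 1, yB} : Finset (ZMod 61)), (w * b').val = q := by
        rcases hq with rfl | rfl | rfl
        · exact ⟨0, by simp, by simp⟩
        · exact ⟨1, by simp, hvalw1⟩
        · exact ⟨yB, by simp, hvalwy⟩
      obtain ⟨b', hb', rfl⟩ := hq'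
      refine ⟨cc + (a' + w * b'), (hW''eq _).2 ⟨cc, hcc, a' + w * b', ?_, rfl⟩, ?_⟩
      · rw [hXs]; exact add_mem_add ha' (mem_image.2 ⟨b', hb', rfl⟩)
      · rw [← ZMod.val_add, add_assoc]
  have hQ := closure_test_eq hp0 (Nat.xor_lt_two_pow (by rw [fullMask_eq]; norm_num) (Nat.or_lt_two_pow hσ₁lt (rot_lt_two_pow _ _ _)))
    (Nat.mod_lt _ hp0) (Nat.mod_lt _ hp0) hmemQ
  -- closure test (P side): `W″ = (Cτ + w{0,1,yB}) + {0,1,yA}`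
  have hmemP : ∀ v, tb (fullMask 61 ^^^ (σ₁ ||| rot 61 T0 s₁)) v = true ↔ v < 61 ∧ ∃ z, z < 61 ∧
      (∃ e ∈ Cτ + (({0, 1, yB} : Finset (ZMod 61)).image (w * ·)), e.val = z) ∧ ∃ q ∈ [0, 1, y₀], (z + q) % 61 = v := by
    intro v
    rw [hrepW]
    constructor
    · rintro ⟨x, hx, rfl⟩
      obtain ⟨cc, hcc, xx, hxx, rfl⟩ := (hW''eq x).1 hx
      rw [hXs] at hxx
      obtain ⟨a', ha', b'', hb'', rfl⟩ := mem_add.1 hxx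
      refine ⟨(cc + (a' + b'')).val_lt, (cc + b'').val, (cc + b'').val_lt, ⟨cc + b'', add_mem_add hcc hb'', rfl⟩, a'.val, ?_, ?_⟩
      · simp only [mem_insert, mem_singleton] at ha'
        simp only [List.mem_cons, List.not_mem_nil, or_false]
        rcases ha' with rfl | rfl | rfl
        · left; simp
        · right; left; exact hval1
        · right; right; exact hyAval
      · rw [← ZMod.val_add, add_assoc, add_comm b'' a']
    · rintro ⟨-, z, -, ⟨e, he, rfl⟩, q, hq, rfl⟩
      obtain ⟨cc, hcc, b'', hb'', rfl⟩ := mem_add.1 he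
      simp only [List.mem_cons, List.not_mem_nil, or_false] at hq
      have hq' : ∃ a' ∈ ({0, 1, yA} : Finset (ZMod 61)), a'.val = q := by
        rcases hq with rfl | rfl | rfl
        · exact ⟨0, by simp, by simp⟩
        · exact ⟨1, by simp, hval1⟩
        · exact ⟨yA, by simp, hyAval⟩
      obtain ⟨a', ha', rfl⟩ := hq'
      refine ⟨cc + (a' + b''), (hW''eq _).2 ⟨cc, hcc, a' + b'', ?_, rfl⟩, ?_⟩
      · rw [hXs]; exact add_mem_add ha' hb''
      · rw [← ZMod.val_add, add_assoc, add_comm b'' a']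
  have hP := closure_test_eq hp0 (Nat.xor_lt_two_pow (by rw [fullMask_eq]; norm_num) (Nat.or_lt_two_pow hσ₁lt (rot_lt_two_pow _ _ _)))
    (by norm_num : 1 < 61) (by omega : y₀ < 61) hmemP
  -- admissibility of `s₁`
  obtain ⟨hadm, hnotfull⟩ := mem_admissible_of_disjoint (T0 := T0) hσ₁lt hs₁lt (fun t ht htb => by
    rw [Bool.eq_false_iff]
    intro hσ
    refine hdisjστ ((s₁ + t) % 61) ⟨hσ, ?_⟩
    rw [tb_rot hT0lt hs₁lt.le (Nat.mod_lt _ hp0), add_comm s₁ t, mod_add_sub_cancel ht hs₁lt.le, htb])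
  -- the stage-1 row at `b = (y₀', σ₂)`, dilation `w.val`, shape `a = (y₀, σ₁)`
  have hwmem : w.val ∈ List.range' 1 60 := by rw [List.mem_range'_1]; omega
  have hplace := place22_of_row (hS1 (y₀', σ₂) hshpB w.val hwmem) hshpA
  dsimp only at hplace
  rw [← hT0] at hplace
  have hQb : Nat.beq (((fullMask 61 ^^^ (σ₁ ||| rot 61 T0 s₁)) &&& rot 61 (fullMask 61 ^^^ (σ₁ ||| rot 61 T0 s₁)) (61 - w.val % 61) &&& rot 61 (fullMask 61 ^^^ (σ₁ ||| rot 61 T0 s₁)) (61 - w.val * y₀' % 61)) |||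
      rot 61 ((fullMask 61 ^^^ (σ₁ ||| rot 61 T0 s₁)) &&& rot 61 (fullMask 61 ^^^ (σ₁ ||| rot 61 T0 s₁)) (61 - w.val % 61) &&& rot 61 (fullMask 61 ^^^ (σ₁ ||| rot 61 T0 s₁)) (61 - w.val * y₀' % 61)) (w.val % 61) |||
      rot 61 ((fullMask 61 ^^^ (σ₁ ||| rot 61 T0 s₁)) &&& rot 61 (fullMask 61 ^^^ (σ₁ ||| rot 61 T0 s₁)) (61 - w.val % 61) &&& rot 61 (fullMask 61 ^^^ (σ₁ ||| rot 61 T0 s₁)) (61 - w.val * y₀' % 61)) (w.val * y₀' % 61)) (fullMask 61 ^^^ (σ₁ ||| rot 61 T0 s₁)) = true := by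
    rw [hQ]; exact Nat.beq_refl _
  have hPb : Nat.beq (((fullMask 61 ^^^ (σ₁ ||| rot 61 T0 s₁)) &&& rot 61 (fullMask 61 ^^^ (σ₁ ||| rot 61 T0 s₁)) (61 - 1) &&& rot 61 (fullMask 61 ^^^ (σ₁ ||| rot 61 T0 s₁)) (61 - y₀)) ||| rot 61 ((fullMask 61 ^^^ (σ₁ ||| rot 61 T0 s₁)) &&& rot 61 (fullMask 61 ^^^ (σ₁ ||| rot 61 T0 s₁)) (61 - 1) &&& rot 61 (fullMask 61 ^^^ (σ₁ ||| rot 61 T0 s₁)) (61 - y₀)) 1 |||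
      rot 61 ((fullMask 61 ^^^ (σ₁ ||| rot 61 T0 s₁)) &&& rot 61 (fullMask 61 ^^^ (σ₁ ||| rot 61 T0 s₁)) (61 - 1) &&& rot 61 (fullMask 61 ^^^ (σ₁ ||| rot 61 T0 s₁)) (61 - y₀)) y₀) (fullMask 61 ^^^ (σ₁ ||| rot 61 T0 s₁)) = true := by
    rw [hP]; exact Nat.beq_refl _
  have hπ : (y₀, σ₁, y₀', σ₂, w.val, s₁) ∈ plc22 := mem_plc_of_place22 hplace hadm hnotfull hQb hPb hK
  -- ── S8: stage 2 ⇒ the realisation `(Y°', Z°')` is in the dead table ⇒ CoverDead ⇒ False ──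
  have hreal : real22 61 zooNrm61 tbl22G (y₀, σ₁, y₀', σ₂, w.val, s₁) = true := by
    have h := hS2; rw [List.all_eq_true] at h; exact h _ hπ
  have hlook := lookup22_of_real22 hreal hnlA hnlB
  -- the mask of `Z°'`
  have hZ3two : (Y''.image (w * ·)).image (· + w * e₂) = DU A3 C3 (univ.erase i) := by
    rw [hZ3Y'']
    conv_lhs => rw [image_image]
    exact image_congr fun x _ => by simp only [Function.comp]; ring
  have hrepZ0 := rep_rot (rep_dilMask hrepY'' w) (w * e₂)
  rw [hZ3two] at hrepZ0
  have hrepZ : ∀ v, tb (rot 61 (dilMask 61 m₂ w.val) (w * e₂).val) v = true ↔ ∃ x ∈ DU A3 C3 (univ.erase i), x.val = v := hrepZ0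
  have hidx : (s₁ + t₁ + 61 * 61 - w.val * t₂) % 61 = (w * e₂).val := by
    have hle : w.val * t₂ ≤ s₁ + t₁ + 61 * 61 := by
      have hm := Nat.mul_le_mul w.val_lt.le ht₂lt.le
      omega
    have e_s : ((s₁ : ℕ) : ZMod 61) = (c : ZMod 61) + (τ.val : ZMod 61) := by rw [hs₁, ZMod.natCast_mod, Nat.cast_add]
    have e_c : ((c : ℕ) : ZMod 61) = (w.val : ZMod 61) * (t₂ : ZMod 61) + ((w * e₂).val : ZMod 61) := by
      rw [hcdef, ZMod.natCast_mod, Nat.cast_add, ZMod.natCast_mod, Nat.cast_mul]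
    have e_τ : ((t₁ : ℕ) : ZMod 61) + (τ.val : ZMod 61) = 0 := by
      have h := congrArg (fun n : ℕ => (n : ZMod 61)) hτval
      simpa [ZMod.natCast_mod, Nat.cast_add] using h
    have h61 : (3721 : ZMod 61) = 0 := by
      rw [show (3721 : ZMod 61) = ((61 : ℕ) : ZMod 61) * ((61 : ℕ) : ZMod 61) by push_cast; norm_num, ZMod.natCast_self, zero_mul]
    have key : ((s₁ + t₁ + 61 * 61 - w.val * t₂) % 61) % 61 = (w * e₂).val % 61 := by
      refine (ZMod.natCast_eq_natCast_iff' _ _ 61).1 ?_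
      rw [ZMod.natCast_mod, Nat.cast_sub hle]
      push_cast
      linear_combination e_s + e_c + e_τ + h61
    rwa [Nat.mod_eq_of_lt (Nat.mod_lt _ hp0), Nat.mod_eq_of_lt (w * e₂).val_lt] at key
  rw [hidx] at hlook
  obtain ⟨g, hg, hg1, hg2⟩ := exists_of_lookup22 hlook
  have hsub' := hsub
  rw [List.all_eq_true] at hsub'
  have hg' := hsub' g hg
  rw [List.all_eq_true, hg1] at hg'
  have hany := hg' _ hg2
  have hmemF := mem_of_any_beq_pair hany
  obtain ⟨hmemYl, hndY⟩ := mem_members_of_rep hrepY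
  obtain ⟨hmemZl, hndZ⟩ := mem_members_of_rep hrepZ
  exact hdead _ hmemF A3 B3 C3 hS3' hA3ne hB3ne hC3ne ks hks hksi hszs3 hndY hndZ hmemYl hmemZl

end Summit.MatrixMultiplication.OmegaCensus.CubeNB.S2
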